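import Summits.Ventures.Crystal3D.Theorems.StickyWulffConstantTextureLiminfTexShadowFluxDefs
import Summits.Ventures.Crystal3D.Theorems.StickyWulffConstantGenericWallFloorSlotSum
import HarnessLib

/-!
# The model zigzag step of a bilayer: the e-best upward bond, its rise `bilayerRise`, its layer bookkeeping, and the
# uniform rise bounds `1/4 ≤ bilayerRise ≤ 1` (lane T, flux count F2e; crux `TextureLiminf`, stmt-Ventures-19483)

HONEST FRAMING. Venture `Summits/Ventures/Crystal3D` (cell `crystal3d-full`), helper `--supports` the crux
`TextureLiminf` (stmt-Ventures-19483) of `route-Ventures-StickyWulffConstant`, registered line `TexShadow` (v6.6; cf-p1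
ROUTE.md §86(42) AK: flux count of the per-top walker families, owner wulff-p2).  Rung credit only; F-C1 not moved.

In MODEL coordinates of the plate's stacking `barlowStacking 1 √(2/3) σ` (frame `L`, cell direction `e`, `ν = L⁻¹ e`),
the zigzag walker of bilayer `i` steps by the e-best inter-layer bond pointing e-upward (`…TexShadowFluxDefs`:
`bondRise`, `bilayerRise`).  This file realises that step as a vector and records what the flux count
(`…FluxChart/FluxLines/FluxDrift`) needs about it:

* `best3`, `best3_mem`, `apply_best3` — an argmax among three;
* `modelStep L σ e i` — `sgn • w*` (`σ i = 1`) resp. `sgn • M(−w*)` (`σ i ≠ 1`), `w*` the best reference upper slot,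
  `sgn = sign ν₂`, `M` the basal mirror; `inner_modelStep` — `⟪modelStep, ν⟫ = bilayerRise L σ e i`;
  `norm_modelStep` (`= 1`), `modelStep_apply_two` (`= sgn·√(2/3)`);
* `barlowPos_add_upSlot` / `barlowPos_add_mirror_upSlot` — adding an upper slot (resp. a mirrored negative upper slot)
  to a site of a `Δ`- (resp. `∇`-) bilayer's lower layer gives a site of its upper layer; `add_modelStep_mem_barlowLayer` —
  the step maps layer to adjacent layer in the e-upward direction;
* `bilayerRise_le_one`, **`quarter_le_bilayerRise`** (`‖e‖ = 1`): every zigzag step rises between `1/4` and `1` along the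
  cell vertical, uniformly in word and orientation (the three upper slots' lateral parts are at `120°`).
WHAT THIS IS NOT: not the flux count; F-C1 not moved.
-/

noncomputable section

namespace Summit.Ventures.Crystal3D.Theorems

open scoped InnerProductSpace
open Literature.MathematicalPhysics.StatisticalMechanics (barlowPos barlowLayer barlowStacking constHagg haggLabel
  haggLabel_succ haggLabel_const basalMirror basalMirror_apply_coord barlowPos_apply_zero barlowPos_apply_one barlowPos_apply_two)
open Summit.Ventures.Crystal3D.Cruxes.TextureLiminf.TexShadow (E3 upSlot₁ upSlot₂ upSlot₃ bondRise bilayerRise)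

/-! ## An argmax among three -/

/-- A maximiser of `f` among `a, b, c`. -/
def best3 (f : E3 → ℝ) (a b c : E3) : E3 :=
  if f b ≤ f a ∧ f c ≤ f a then a else if f c ≤ f b then b else c

/-- The maximiser is one of the three. -/
theorem best3_mem (f : E3 → ℝ) (a b c : E3) : best3 f a b c = a ∨ best3 f a b c = b ∨ best3 f a b c = c := by
  unfold best3; split_ifs <;> simp

/-- Its value is the maximum. -/
theorem apply_best3 (f : E3 → ℝ) (a b c : E3) : f (best3 f a b c) = max (max (f a) (f b)) (f c) := by
  unfold best3
  split_ifs with h1 h2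
  · rw [max_eq_left h1.1, max_eq_left h1.2]
  · rw [not_and_or, not_le, not_le] at h1
    rcases h1 with h1 | h1
    · rw [max_eq_right h1.le, max_eq_left h2]
    · have hb : f a < f b := lt_of_lt_of_le h1 h2
      rw [max_eq_right hb.le, max_eq_left h2]
  · push Not at h2
    symm; apply max_eq_right
    rcases le_or_gt (f b) (f a) with hab | hab
    · rw [max_eq_left hab]; push Not at h1; exact (h1 hab).le
    · rw [max_eq_right hab.le]; exact h2.le

/-! ## The model step -/

/-- The orientation sign of the stacking axis against the cell direction: `+1` if `ν₂ ≥ 0`, else `−1`. -/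
def axisSign (L : E3 ≃ₗᵢ[ℝ] E3) (e : E3) : ℝ := if 0 ≤ (L.symm e) 2 then 1 else -1

/-- `axisSign² = 1`. -/
theorem axisSign_mul_self (L : E3 ≃ₗᵢ[ℝ] E3) (e : E3) : axisSign L e * axisSign L e = 1 := by
  unfold axisSign; split_ifs <;> norm_num

/-- `|axisSign| = 1`. -/
theorem abs_axisSign (L : E3 ≃ₗᵢ[ℝ] E3) (e : E3) : |axisSign L e| = 1 := by
  unfold axisSign; split_ifs <;> norm_num

/-- The best reference upper slot of bilayer `i`. -/
def bestUpSlot (L : E3 ≃ₗᵢ[ℝ] E3) (σ : ℤ → ℤ) (e : E3) (i : ℤ) : E3 :=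
  best3 (bondRise L σ e i) upSlot₁ upSlot₂ upSlot₃

/-- **The model zigzag step of bilayer `i` toward `e`.** -/
def modelStep (L : E3 ≃ₗᵢ[ℝ] E3) (σ : ℤ → ℤ) (e : E3) (i : ℤ) : E3 :=
  axisSign L e • (if σ i = 1 then bestUpSlot L σ e i else basalMirror (-(bestUpSlot L σ e i)))

/-- The basal mirror is self-adjoint. -/
theorem inner_basalMirror_comm (x y : E3) : ⟪basalMirror x, y⟫_ℝ = ⟪x, basalMirror y⟫_ℝ := by
  have h := LinearIsometryEquiv.inner_map_map basalMirror x (basalMirror y)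
  rw [Literature.MathematicalPhysics.StatisticalMechanics.basalMirror_basalMirror] at h
  exact h

/-- **The rise of the model step is `bilayerRise`.** -/
theorem inner_modelStep (L : E3 ≃ₗᵢ[ℝ] E3) (σ : ℤ → ℤ) (e : E3) (i : ℤ) :
    ⟪modelStep L σ e i, L.symm e⟫_ℝ = bilayerRise L σ e i := by
  have hval : bondRise L σ e i (bestUpSlot L σ e i) = bilayerRise L σ e i := apply_best3 _ _ _ _
  rw [← hval, modelStep, inner_smul_left, RCLike.conj_to_real, bondRise]
  unfold axisSign
  by_cases hσ : σ i = 1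
  · simp [hσ]
  · simp only [hσ, if_false]
    rw [inner_basalMirror_comm, inner_neg_left]

/-- In physical coordinates: `⟪L (modelStep), e⟫ = bilayerRise`. -/
theorem inner_map_modelStep (L : E3 ≃ₗᵢ[ℝ] E3) (σ : ℤ → ℤ) (e : E3) (i : ℤ) :
    ⟪L (modelStep L σ e i), e⟫_ℝ = bilayerRise L σ e i := by
  rw [← inner_modelStep L σ e i, ← LinearIsometryEquiv.inner_map_map L (modelStep L σ e i) (L.symm e),
    LinearIsometryEquiv.apply_symm_apply]

/-! ## The reference upper slots -/

/-- The three upper slots are slots of `Λ₀`. -/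
theorem upSlots_mem_fccSlots : upSlot₁ ∈ fccSlots ∧ upSlot₂ ∈ fccSlots ∧ upSlot₃ ∈ fccSlots := by
  refine ⟨?_, ?_, ?_⟩ <;> rw [fccSlots, Finset.mem_image]
  · exact ⟨(1, 0, 0), by simp [fccSlotTriples], rfl⟩
  · exact ⟨(1, -1, 0), by simp [fccSlotTriples], rfl⟩
  · exact ⟨(1, 0, -1), by simp [fccSlotTriples], rfl⟩

/-- The best upper slot is a unit vector with height `√(2/3)`. -/
theorem bestUpSlot_spec (L : E3 ≃ₗᵢ[ℝ] E3) (σ : ℤ → ℤ) (e : E3) (i : ℤ) :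
    ‖bestUpSlot L σ e i‖ = 1 ∧ bestUpSlot L σ e i 2 = Real.sqrt (2 / 3) ∧
      ∃ a b : ℤ, ((a = 0 ∧ b = 0) ∨ (a = -1 ∧ b = 0) ∨ (a = 0 ∧ b = -1)) ∧
        bestUpSlot L σ e i = barlowPos 1 (Real.sqrt (2 / 3)) constHagg 1 a b := by
  obtain ⟨h1, h2, h3⟩ := upSlots_mem_fccSlots
  rcases best3_mem (bondRise L σ e i) upSlot₁ upSlot₂ upSlot₃ with h | h | h <;> rw [bestUpSlot, h]
  · exact ⟨norm_eq_one_of_mem_fccSlots h1, by simp [upSlot₁, barlowPos_apply_two], 0, 0, by simp, rfl⟩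
  · exact ⟨norm_eq_one_of_mem_fccSlots h2, by simp [upSlot₂, barlowPos_apply_two], -1, 0, by simp, rfl⟩
  · exact ⟨norm_eq_one_of_mem_fccSlots h3, by simp [upSlot₃, barlowPos_apply_two], 0, -1, by simp, rfl⟩

/-- **The step is a unit vector.** -/
theorem norm_modelStep (L : E3 ≃ₗᵢ[ℝ] E3) (σ : ℤ → ℤ) (e : E3) (i : ℤ) : ‖modelStep L σ e i‖ = 1 := by
  obtain ⟨hn, -, -⟩ := bestUpSlot_spec L σ e i
  rw [modelStep, norm_smul, Real.norm_eq_abs, abs_axisSign, one_mul]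
  split_ifs
  · exact hn
  · rw [LinearIsometryEquiv.norm_map, norm_neg, hn]

/-- The model height of the step: `(modelStep)₂ = axisSign · √(2/3)`. -/
theorem modelStep_apply_two (L : E3 ≃ₗᵢ[ℝ] E3) (σ : ℤ → ℤ) (e : E3) (i : ℤ) :
    modelStep L σ e i 2 = axisSign L e * Real.sqrt (2 / 3) := by
  obtain ⟨-, h2, -⟩ := bestUpSlot_spec L σ e i
  rw [modelStep, PiLp.smul_apply, smul_eq_mul]
  split_ifs
  · rw [h2]
  · rw [basalMirror_apply_coord, if_pos rfl, PiLp.neg_apply, neg_neg, h2]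

/-! ## Layer bookkeeping -/

/-- `Δ`-bilayer: a site of layer `i` plus a reference upper slot is a site of layer `i + 1`. -/
theorem barlowPos_add_upSlot (σ : ℤ → ℤ) (i : ℤ) (hσ : σ i = 1) (x y a b : ℤ) :
    barlowPos 1 (Real.sqrt (2 / 3)) σ i x y + barlowPos 1 (Real.sqrt (2 / 3)) constHagg 1 a b =
      barlowPos 1 (Real.sqrt (2 / 3)) σ (i + 1) (x + a) (y + b) := by
  ext t
  fin_cases t <;>
    simp [barlowPos_apply_zero, barlowPos_apply_one, barlowPos_apply_two, haggLabel_succ, hσ] <;> ring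

/-- `∇`-bilayer: a site of layer `i` plus the mirrored negative of a reference upper slot is a site of layer `i + 1`. -/
theorem barlowPos_add_mirror_upSlot (σ : ℤ → ℤ) (i : ℤ) (hσ : σ i = -1) (x y a b : ℤ) :
    barlowPos 1 (Real.sqrt (2 / 3)) σ i x y + basalMirror (-barlowPos 1 (Real.sqrt (2 / 3)) constHagg 1 a b) =
      barlowPos 1 (Real.sqrt (2 / 3)) σ (i + 1) (x - a) (y - b) := by
  ext t
  fin_cases t <;>
    simp [barlowPos_apply_zero, barlowPos_apply_one, barlowPos_apply_two, haggLabel_succ, hσ,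
      basalMirror_apply_coord] <;> ring

/-- **The step maps a layer to the adjacent layer, e-upward.**  For a Hägg word: if `axisSign = 1`, a site of layer `i`
plus the step of bilayer `i` is a site of layer `i + 1`; if `axisSign = −1`, a site of layer `i + 1` plus the step is a
site of layer `i`. -/
theorem add_modelStep_mem_barlowLayer (L : E3 ≃ₗᵢ[ℝ] E3) {σ : ℤ → ℤ}
    (hσ : Literature.MathematicalPhysics.StatisticalMechanics.IsHaggSeq σ) (e : E3) (i : ℤ) (q : E3) :
    (0 ≤ (L.symm e) 2 → q ∈ barlowLayer 1 (Real.sqrt (2 / 3)) σ i →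
        q + modelStep L σ e i ∈ barlowLayer 1 (Real.sqrt (2 / 3)) σ (i + 1)) ∧
    (¬ 0 ≤ (L.symm e) 2 → q ∈ barlowLayer 1 (Real.sqrt (2 / 3)) σ (i + 1) →
        q + modelStep L σ e i ∈ barlowLayer 1 (Real.sqrt (2 / 3)) σ i) := by
  obtain ⟨-, -, a, b, -, hw⟩ := bestUpSlot_spec L σ e i
  constructor
  · rintro hs ⟨x, y, rfl⟩
    rw [modelStep, axisSign, if_pos hs, one_smul, hw]
    rcases hσ i with h1 | h1
    · rw [if_pos h1, barlowPos_add_upSlot σ i h1]; exact ⟨_, _, rfl⟩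
    · rw [if_neg (by rw [h1]; norm_num), barlowPos_add_mirror_upSlot σ i h1]; exact ⟨_, _, rfl⟩
  · rintro hs ⟨x, y, rfl⟩
    rw [modelStep, axisSign, if_neg hs, neg_one_smul, hw]
    rcases hσ i with h1 | h1
    · rw [if_pos h1]
      refine ⟨x - a, y - b, ?_⟩
      have := barlowPos_add_upSlot σ i h1 (x - a) (y - b) a b
      rw [sub_add_cancel, sub_add_cancel] at this
      rw [← this]; abel
    · rw [if_neg (by rw [h1]; norm_num)]
      refine ⟨x + a, y + b, ?_⟩
      have := barlowPos_add_mirror_upSlot σ i h1 (x + a) (y + b) a b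
      rw [add_sub_cancel_right, add_sub_cancel_right] at this
      rw [← this]; abel

/-! ## Rise bounds -/

/-- Every zigzag step rises at most `1` (for a unit cell direction). -/
theorem bilayerRise_le_one (L : E3 ≃ₗᵢ[ℝ] E3) (σ : ℤ → ℤ) {e : E3} (he : ‖e‖ = 1) (i : ℤ) :
    bilayerRise L σ e i ≤ 1 := by
  rw [← inner_modelStep]
  have h := real_inner_le_norm (modelStep L σ e i) (L.symm e)
  rwa [norm_modelStep, LinearIsometryEquiv.norm_map, he, one_mul] at h

/-- The lateral parts of the three upper slots are at `120°`: their best alignment with any planar vector `(x₀, x₁)`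
is at least `|x|/(2√3) ≥ … `; we use the squared form `max ≥ 0` and `12·max² ≥ x₀² + x₁²`. -/
theorem max_lateral_upSlots (x₀ x₁ : ℝ) :
    0 ≤ max (max (x₀ / 2 + Real.sqrt 3 / 6 * x₁) (-(x₀ / 2) + Real.sqrt 3 / 6 * x₁)) (-(Real.sqrt 3 / 3) * x₁) ∧
    x₀ ^ 2 + x₁ ^ 2 ≤ 12 * (max (max (x₀ / 2 + Real.sqrt 3 / 6 * x₁) (-(x₀ / 2) + Real.sqrt 3 / 6 * x₁))
      (-(Real.sqrt 3 / 3) * x₁)) ^ 2 := by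
  have h3 : Real.sqrt 3 ^ 2 = 3 := Real.sq_sqrt (by norm_num)
  have hs3 : 0 < Real.sqrt 3 := Real.sqrt_pos.2 (by norm_num)
  set M := max (max (x₀ / 2 + Real.sqrt 3 / 6 * x₁) (-(x₀ / 2) + Real.sqrt 3 / 6 * x₁)) (-(Real.sqrt 3 / 3) * x₁)
    with hM
  have hM1 : x₀ / 2 + Real.sqrt 3 / 6 * x₁ ≤ M := le_trans (le_max_left _ _) (le_max_left _ _)
  have hM2 : -(x₀ / 2) + Real.sqrt 3 / 6 * x₁ ≤ M := le_trans (le_max_right _ _) (le_max_left _ _)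
  have hM3 : -(Real.sqrt 3 / 3) * x₁ ≤ M := le_max_right _ _
  have hMabs : |x₀| / 2 + Real.sqrt 3 / 6 * x₁ ≤ M := by
    rcases le_or_gt 0 x₀ with h | h
    · rw [abs_of_nonneg h]; exact hM1
    · rw [abs_of_neg h]; linarith
  have hM0 : 0 ≤ M := by
    rcases le_or_gt 0 x₁ with h | h
    · have : 0 ≤ Real.sqrt 3 / 6 * x₁ := by positivity
      linarith [abs_nonneg x₀]
    · nlinarith
  refine ⟨hM0, ?_⟩
  have hx0 : x₀ ^ 2 = |x₀| ^ 2 := (sq_abs x₀).symm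
  rcases le_or_gt 0 x₁ with h | h
  · -- `M ≥ |x₀|/2 + (√3/6) x₁` with both terms nonnegative
    have ha : 0 ≤ |x₀| := abs_nonneg _
    nlinarith [hMabs, sq_nonneg (|x₀| - Real.sqrt 3 * x₁)]
  · -- `x₁ < 0`: compare `|x₀|` with `3|x₁|·(√3/3)·…`
    rcases le_or_gt (|x₀| / 2 + Real.sqrt 3 / 6 * x₁) (-(Real.sqrt 3 / 3) * x₁) with h' | h'
    · -- `M ≥ −(√3/3)x₁` and `|x₀| ≤ −√3 x₁`
      have hb : |x₀| ≤ -(Real.sqrt 3) * x₁ := by nlinarith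
      have hM' : 0 ≤ -(Real.sqrt 3 / 3) * x₁ := by nlinarith
      nlinarith [abs_nonneg x₀]
    · have hb : -(Real.sqrt 3) * x₁ < |x₀| := by nlinarith
      nlinarith [abs_nonneg x₀, hMabs]

/-- Arithmetic core of the rise bound: `M ≥ 0`, `t ≥ 0`, `1 − t² ≤ 12 M²` give `M + √(2/3)·t ≥ 1/4`. -/
theorem quarter_le_of_lateral_bound (M t : ℝ) (hM0 : 0 ≤ M) (ht : 0 ≤ t) (hM : 1 - t ^ 2 ≤ 12 * M ^ 2) :
    1 / 4 ≤ M + Real.sqrt (2 / 3) * t := by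
  have h23 : Real.sqrt (2 / 3) ^ 2 = 2 / 3 := Real.sq_sqrt (by norm_num)
  have hs23 : 0 < Real.sqrt (2 / 3) := Real.sqrt_pos.2 (by norm_num)
  by_cases hA : 1 / 4 ≤ Real.sqrt (2 / 3) * t
  · linarith
  · push Not at hA
    have hst0 : 0 ≤ Real.sqrt (2 / 3) * t := mul_nonneg hs23.le ht
    have ht2 : t ^ 2 < 3 / 32 := by nlinarith
    have hM2 : 1 / 16 < M ^ 2 := by nlinarith
    have hM4 : 1 / 4 < M := by nlinarith
    linarith

set_option maxHeartbeats 400000 in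
/-- **Every zigzag step rises at least `1/4`** (for a unit cell direction), uniformly in word and orientation. -/
theorem quarter_le_bilayerRise (L : E3 ≃ₗᵢ[ℝ] E3) (σ : ℤ → ℤ) {e : E3} (he : ‖e‖ = 1) (i : ℤ) :
    1 / 4 ≤ bilayerRise L σ e i := by
  set ν : E3 := L.symm e with hν
  have hνn : ‖ν‖ = 1 := by rw [hν, LinearIsometryEquiv.norm_map, he]
  have hν2 : ν 0 ^ 2 + ν 1 ^ 2 + ν 2 ^ 2 = 1 := by
    have := EuclideanSpace.norm_sq_eq ν
    rw [hνn, one_pow, Fin.sum_univ_three] at this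
    simp only [Real.norm_eq_abs, sq_abs] at this
    linarith
  have h3 : Real.sqrt 3 ^ 2 = 3 := Real.sq_sqrt (by norm_num)
  have h23 : Real.sqrt (2 / 3) ^ 2 = 2 / 3 := Real.sq_sqrt (by norm_num)
  have hs23 : 0 < Real.sqrt (2 / 3) := Real.sqrt_pos.2 (by norm_num)
  -- the three candidate rises, in coordinates
  have hrises : ∀ w : E3, bondRise L σ e i w =
      axisSign L e * (if σ i = 1 then (w 0 * ν 0 + w 1 * ν 1 + w 2 * ν 2) else -(w 0 * ν 0 + w 1 * ν 1 - w 2 * ν 2)) := by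
    intro w
    rw [bondRise, axisSign, ← hν]
    congr 1
    split_ifs
    · simp [PiLp.inner_apply, Fin.sum_univ_three, mul_comm]
    · simp [PiLp.inner_apply, Fin.sum_univ_three, basalMirror_apply_coord, mul_comm]; ring
  have hval : bilayerRise L σ e i = max (max (bondRise L σ e i upSlot₁) (bondRise L σ e i upSlot₂))
      (bondRise L σ e i upSlot₃) := rfl
  -- coordinates of the slots
  have c1 : upSlot₁ 0 = 1 / 2 ∧ upSlot₁ 1 = Real.sqrt 3 / 6 ∧ upSlot₁ 2 = Real.sqrt (2 / 3) := by
    refine ⟨?_, ?_, ?_⟩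
    · simp [upSlot₁, barlowPos_apply_zero]
    · simp [upSlot₁, barlowPos_apply_one]; ring
    · simp [upSlot₁, barlowPos_apply_two]
  have c2 : upSlot₂ 0 = -(1 / 2) ∧ upSlot₂ 1 = Real.sqrt 3 / 6 ∧ upSlot₂ 2 = Real.sqrt (2 / 3) := by
    refine ⟨?_, ?_, ?_⟩ <;> simp [upSlot₂, barlowPos_apply_zero, barlowPos_apply_one, barlowPos_apply_two] <;> ring
  have c3 : upSlot₃ 0 = 0 ∧ upSlot₃ 1 = -(Real.sqrt 3 / 3) ∧ upSlot₃ 2 = Real.sqrt (2 / 3) := by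
    refine ⟨?_, ?_, ?_⟩ <;> simp [upSlot₃, barlowPos_apply_zero, barlowPos_apply_one, barlowPos_apply_two] <;> ring
  rw [hval, hrises, hrises, hrises, c1.1, c1.2.1, c1.2.2, c2.1, c2.2.1, c2.2.2, c3.1, c3.2.1, c3.2.2]
  -- reduce both classes to `|ν₂|√(2/3) + (lateral max at ±ν_lat)`
  unfold axisSign
  by_cases hσ : σ i = 1 <;> simp only [hσ, if_true, if_false] <;> split_ifs with hs
  · -- Δ, sgn = 1
    obtain ⟨hM0, hM⟩ := max_lateral_upSlots (ν 0) (ν 1)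
    set M := max (max (ν 0 / 2 + Real.sqrt 3 / 6 * ν 1) (-(ν 0 / 2) + Real.sqrt 3 / 6 * ν 1)) (-(Real.sqrt 3 / 3) * ν 1)
    have hrew : max (max (1 * (1 / 2 * ν 0 + Real.sqrt 3 / 6 * ν 1 + Real.sqrt (2 / 3) * ν 2))
        (1 * (-(1 / 2) * ν 0 + Real.sqrt 3 / 6 * ν 1 + Real.sqrt (2 / 3) * ν 2)))
        (1 * (0 * ν 0 + -(Real.sqrt 3 / 3) * ν 1 + Real.sqrt (2 / 3) * ν 2)) = M + Real.sqrt (2 / 3) * ν 2 := by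
      simp only [one_mul, zero_mul, zero_add]
      rw [show 1 / 2 * ν 0 + Real.sqrt 3 / 6 * ν 1 + Real.sqrt (2 / 3) * ν 2 =
        (ν 0 / 2 + Real.sqrt 3 / 6 * ν 1) + Real.sqrt (2 / 3) * ν 2 by ring,
        show -(1 / 2) * ν 0 + Real.sqrt 3 / 6 * ν 1 + Real.sqrt (2 / 3) * ν 2 =
        (-(ν 0 / 2) + Real.sqrt 3 / 6 * ν 1) + Real.sqrt (2 / 3) * ν 2 by ring,
        show -(Real.sqrt 3 / 3) * ν 1 + Real.sqrt (2 / 3) * ν 2 = (-(Real.sqrt 3 / 3) * ν 1) + Real.sqrt (2 / 3) * ν 2 by ring,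
        max_add_add_right, max_add_add_right]
    rw [hrew]
    have hs' : 0 ≤ ν 2 := by rw [hν]; exact hs
    exact quarter_le_of_lateral_bound M (ν 2) hM0 hs' (by nlinarith [hM, hν2])
  · -- Δ, sgn = -1
    push Not at hs
    obtain ⟨hM0, hM⟩ := max_lateral_upSlots (-ν 0) (-ν 1)
    set M := max (max (-ν 0 / 2 + Real.sqrt 3 / 6 * -ν 1) (-(-ν 0 / 2) + Real.sqrt 3 / 6 * -ν 1))
      (-(Real.sqrt 3 / 3) * -ν 1)
    have hrew : max (max (-1 * (1 / 2 * ν 0 + Real.sqrt 3 / 6 * ν 1 + Real.sqrt (2 / 3) * ν 2))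
        (-1 * (-(1 / 2) * ν 0 + Real.sqrt 3 / 6 * ν 1 + Real.sqrt (2 / 3) * ν 2)))
        (-1 * (0 * ν 0 + -(Real.sqrt 3 / 3) * ν 1 + Real.sqrt (2 / 3) * ν 2)) = M + Real.sqrt (2 / 3) * (-ν 2) := by
      rw [show -1 * (1 / 2 * ν 0 + Real.sqrt 3 / 6 * ν 1 + Real.sqrt (2 / 3) * ν 2) =
        (-ν 0 / 2 + Real.sqrt 3 / 6 * -ν 1) + Real.sqrt (2 / 3) * (-ν 2) by ring,
        show -1 * (-(1 / 2) * ν 0 + Real.sqrt 3 / 6 * ν 1 + Real.sqrt (2 / 3) * ν 2) =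
        (-(-ν 0 / 2) + Real.sqrt 3 / 6 * -ν 1) + Real.sqrt (2 / 3) * (-ν 2) by ring,
        show -1 * (0 * ν 0 + -(Real.sqrt 3 / 3) * ν 1 + Real.sqrt (2 / 3) * ν 2) =
        (-(Real.sqrt 3 / 3) * -ν 1) + Real.sqrt (2 / 3) * (-ν 2) by ring,
        max_add_add_right, max_add_add_right]
    rw [hrew]
    have hM' : ν 0 ^ 2 + ν 1 ^ 2 ≤ 12 * M ^ 2 := by simpa using hM
    have hs' : 0 ≤ -ν 2 := by rw [hν]; linarith
    exact quarter_le_of_lateral_bound M (-ν 2) hM0 hs' (by nlinarith [hM', hν2])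
  · -- ∇, sgn = 1
    obtain ⟨hM0, hM⟩ := max_lateral_upSlots (-ν 0) (-ν 1)
    set M := max (max (-ν 0 / 2 + Real.sqrt 3 / 6 * -ν 1) (-(-ν 0 / 2) + Real.sqrt 3 / 6 * -ν 1))
      (-(Real.sqrt 3 / 3) * -ν 1)
    have hrew : max (max (1 * -(1 / 2 * ν 0 + Real.sqrt 3 / 6 * ν 1 - Real.sqrt (2 / 3) * ν 2))
        (1 * -(-(1 / 2) * ν 0 + Real.sqrt 3 / 6 * ν 1 - Real.sqrt (2 / 3) * ν 2)))
        (1 * -(0 * ν 0 + -(Real.sqrt 3 / 3) * ν 1 - Real.sqrt (2 / 3) * ν 2)) = M + Real.sqrt (2 / 3) * ν 2 := by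
      rw [show 1 * -(1 / 2 * ν 0 + Real.sqrt 3 / 6 * ν 1 - Real.sqrt (2 / 3) * ν 2) =
        (-ν 0 / 2 + Real.sqrt 3 / 6 * -ν 1) + Real.sqrt (2 / 3) * ν 2 by ring,
        show 1 * -(-(1 / 2) * ν 0 + Real.sqrt 3 / 6 * ν 1 - Real.sqrt (2 / 3) * ν 2) =
        (-(-ν 0 / 2) + Real.sqrt 3 / 6 * -ν 1) + Real.sqrt (2 / 3) * ν 2 by ring,
        show 1 * -(0 * ν 0 + -(Real.sqrt 3 / 3) * ν 1 - Real.sqrt (2 / 3) * ν 2) =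
        (-(Real.sqrt 3 / 3) * -ν 1) + Real.sqrt (2 / 3) * ν 2 by ring,
        max_add_add_right, max_add_add_right]
    rw [hrew]
    have hM' : ν 0 ^ 2 + ν 1 ^ 2 ≤ 12 * M ^ 2 := by simpa using hM
    have hs' : 0 ≤ ν 2 := by rw [hν]; exact hs
    exact quarter_le_of_lateral_bound M (ν 2) hM0 hs' (by nlinarith [hM', hν2])
  · -- ∇, sgn = -1
    push Not at hs
    obtain ⟨hM0, hM⟩ := max_lateral_upSlots (ν 0) (ν 1)
    set M := max (max (ν 0 / 2 + Real.sqrt 3 / 6 * ν 1) (-(ν 0 / 2) + Real.sqrt 3 / 6 * ν 1)) (-(Real.sqrt 3 / 3) * ν 1)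
    have hrew : max (max (-1 * -(1 / 2 * ν 0 + Real.sqrt 3 / 6 * ν 1 - Real.sqrt (2 / 3) * ν 2))
        (-1 * -(-(1 / 2) * ν 0 + Real.sqrt 3 / 6 * ν 1 - Real.sqrt (2 / 3) * ν 2)))
        (-1 * -(0 * ν 0 + -(Real.sqrt 3 / 3) * ν 1 - Real.sqrt (2 / 3) * ν 2)) = M + Real.sqrt (2 / 3) * (-ν 2) := by
      rw [show -1 * -(1 / 2 * ν 0 + Real.sqrt 3 / 6 * ν 1 - Real.sqrt (2 / 3) * ν 2) =
        (ν 0 / 2 + Real.sqrt 3 / 6 * ν 1) + Real.sqrt (2 / 3) * (-ν 2) by ring,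
        show -1 * -(-(1 / 2) * ν 0 + Real.sqrt 3 / 6 * ν 1 - Real.sqrt (2 / 3) * ν 2) =
        (-(ν 0 / 2) + Real.sqrt 3 / 6 * ν 1) + Real.sqrt (2 / 3) * (-ν 2) by ring,
        show -1 * -(0 * ν 0 + -(Real.sqrt 3 / 3) * ν 1 - Real.sqrt (2 / 3) * ν 2) =
        (-(Real.sqrt 3 / 3) * ν 1) + Real.sqrt (2 / 3) * (-ν 2) by ring,
        max_add_add_right, max_add_add_right]
    rw [hrew]
    have hs' : 0 ≤ -ν 2 := by rw [hν]; linarith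
    exact quarter_le_of_lateral_bound M (-ν 2) hM0 hs' (by nlinarith [hM, hν2])

end Summit.Ventures.Crystal3D.Theorems

end
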